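import Summits.CriticalPhenomena.PercolationContinuityZ3.Theorems.Transplant.KNLevelsTargetChainEdge
import Summits.CriticalPhenomena.PercolationContinuityZ3.Theorems.Transplant.KNLevelsTargetPropertyKN
import HarnessLib

/-!
# F7 (generic), part 3 — the target property UNIFORM IN THE GRAPH on a fixed vertex type (`∃ δ` before `∀ G`), and uniform chains
# (U1, lead g2 V50 (ii); postcont-2 g15's quantifier point)

builds on p205010 (kernel theorem, internal audit signed; external expert review pending) — only `targetPropertyU_KN` uses it (through
`KNLevels.avoidingGluing_KN` ← `CSH.kozmaNitzan_conjecture3_holds`).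
Lane `prim-bschramm`, seat `prim-bschramm-stmt` (gen 3); helper file (`--supports stmt-CriticalPhenomena-4575`).

WHY.  In the `X □ ℤ²` scheme the corridor chain of a history `h` runs in the tube graph `tubeGraph X π_β` whose window `π_β = B_X(β, R)` moves
with the stub anchor `β = dep v` (same vertex type `W × Site 2`, infinitely many graphs), while the node theorem `samePWitnessAt_of_kit₂'` wants
ONE `ε'` and `hreach_of_chain_edge` ONE `δ` fixed with the geometry.  `KNLevels.TargetProperty G Δ p` (p212106) quantifies `∃ δ` AFTER
fixing `G`, so its `δ` cannot be minimised over the anchors.  But in the proof of the generic target lemma (`targetLemma_of_kits`, p2-g2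
p211887) `δ` is built in Step I from the gluing schema `hC` and `ε` alone (`δ = ε · min(δ_{C3}, 1) / 12`) — the graph enters only at Step II.
Hence:
* **`KNLevels.TargetPropertyU V Δ p`** — `∀ ε > 0, ∃ δ ∈ (0,1], ∀ G` (locally finite, `deg ≤ Δ`) the body of `TargetProperty G Δ p` at `(ε, δ)`
  verbatim;
* **`targetPropertyU_of_avoidingGluing`** (`targetLemma_of_kits` with `G` introduced after Step I), **`targetPropertyU_KN`** (unconditional via
  `avoidingGluing_KN`), `TargetPropertyU.targetProperty` (back to the per-graph property; nothing landed is disturbed);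
* the uniform twins of the chain engine: **`TargetPropertyU.apply_step`**, **`TargetPropertyU.chain`**, **`TargetPropertyU.chain_edge`** —
  `∃ δ` before `∀ G' W s …`, bodies of `TargetProperty.apply_step/chain` (stmt p212753) and `TargetProperty.chain_edge` (p2-g2 p216381) verbatim.
[cite: KozmaNitzan2024, §4 Lemma 10 (pp. 17–22), Lemma 11 (p. 22), Lemma 12 (pp. 23–25); Conjecture 3 (p. 15)] [cite: GrimmettPercolation1999, §7.2]
-/

noncomputable section

open MeasureTheory ProbabilityTheory

namespace Summit.CriticalPhenomena.PercolationContinuityZ3.Theorems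

namespace Transplant

namespace KNLevels

open Literature.Probability.Percolation Literature.Probability.LatticeModels SimpleGraph

/-! ## §1 The uniform target property -/

/-- **The target property, uniform in the graph on the vertex type `V`**: for every `ε > 0` ONE `δ ∈ (0,1]` such that for EVERY locally
finite `G : SimpleGraph V` with degrees `≤ Δ` the conclusion of the generic target lemma holds at `(ε, δ)` (body of `TargetProperty G Δ p`
verbatim). [cite: KozmaNitzan2024, §4 Lemma 10 (p. 17)] -/
def TargetPropertyU (V : Type) [DecidableEq V] (Δ : ℕ) (p : unitInterval) : Prop :=
  ∀ ⦃ε : ℝ⦄, 0 < ε → ∃ δ : ℝ, 0 < δ ∧ δ ≤ 1 ∧ ∀ (G : SimpleGraph V) [G.LocallyFinite], (∀ x, G.degree x ≤ Δ) →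
    ∀ (L : LData G) (W : Sym2 V → unitInterval) (D T : Finset V) (R N j₀ j₁ : ℕ),
    LHyp L W p D R → j₁ ≤ R → T ⊆ D → T.Nonempty →
    1 / (1 - (p : ℝ)) ^ (Δ * N) ≤ δ * ((Finset.Icc j₀ j₁).card : ℝ) →
    (∀ j ∈ Finset.Icc j₀ j₁, ∃ (σ : SData V) (S : Finset V), SHyp L j σ ∧ σ.N ≤ N ∧
      (1 - (p : ℝ) ^ σ.sB) ^ σ.k ≤ δ ∧ S ⊆ L.X j ∧ S ⊆ D ∧
      (∀ x ∈ σ.K, ∀ e ∈ σ.seed x, e ∉ wireSet (↑S : Set V)) ∧ (∀ x ∈ σ.K, σ.face x ⊆ S) ∧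
      (∀ x ∈ σ.K, 1 - 3 * δ ≤ (prodBernoulli W).real {ω | ∃ u ∈ σ.face x,
        1 - δ < (prodBernoulli (pinW W (wireSet (↑S : Set V)) ω)).real (⋃ t ∈ T, openConnIn (↑D : Set V) u t)})) →
    1 - δ < (prodBernoulli W).real L.reachB →
      1 - ε < (prodBernoulli W).real (⋃ t ∈ T, openConn L.o t)

variable {V : Type} [DecidableEq V]

/-- **The uniform target property from the avoiding gluing schema**: the proof of `targetLemma_of_kits` with the graph introduced after
Step I (`δ = ε · min(δ_{C3}, 1) / 12` depends on the schema and `ε` only). [cite: KozmaNitzan2024, §4 Lemma 10 (pp. 17–22)] -/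
theorem targetPropertyU_of_avoidingGluing [Countable V] {Δ : ℕ} (hC : AvoidingGluing V) (p : unitInterval) (hp1 : (p : ℝ) < 1) :
    TargetPropertyU V Δ p := by
  classical
  intro ε hε
  -- trivial when `ε > 1`
  rcases le_or_gt ε 1 with hε1 | hε1
  swap
  · refine ⟨1, one_pos, le_rfl, fun G _ _ L W D T R N j₀ j₁ _ _ _ _ _ _ _ => ?_⟩
    exact lt_of_lt_of_le (by linarith) measureReal_nonneg
  -- Step I: the constants `δ_{C3}`, `δ` — from the schema and `ε` only
  obtain ⟨δ₀, hδ₀, hC3⟩ := hC (ε / 2) (half_pos hε)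
  set δc : ℝ := min δ₀ 1 with hδc
  have hδc0 : 0 < δc := lt_min hδ₀ one_pos
  have hδc1 : δc ≤ 1 := min_le_right _ _
  set δ : ℝ := ε * δc / 12 with hδdef
  have hδpos : 0 < δ := by positivity
  have hδc' : δ ≤ δc := by rw [hδdef]; nlinarith
  have h3δ : 3 * δ ≤ 1 := by rw [hδdef]; nlinarith
  have h12 : 12 * δ ≤ ε * δc := by rw [hδdef]; linarith
  have hδ1 : δ ≤ 1 := by linarith
  -- the gluing hypothesis at `δc ≤ δ₀`
  have hC3' : ∀ (w : Sym2 V → unitInterval) (Sf : Finset V), (∀ e : Sym2 V, (∃ x ∈ e, x ∉ Sf) → w e = 0) →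
      ∀ (A T' : Finset V) (o : V) (Rg : Set V), A ⊆ Sf → T' ⊆ Sf → o ∈ Sf → T'.Nonempty → o ∉ Rg →
        1 - δc < (prodBernoulli w).real (⋃ a ∈ A, openConn o a) →
          (∀ a ∈ A, 1 - δc < (prodBernoulli w).real (⋃ t ∈ T', openConnIn Rg a t)) →
            1 - ε / 2 < (prodBernoulli w).real (⋃ t ∈ T', openConn o t) := by
    intro w Sf hw A T' o Rg hA hT' ho hne hoRg hoA haT
    have hle : 1 - δ₀ ≤ 1 - δc := by linarith [min_le_left δ₀ 1]
    exact hC3 w Sf hw A T' o Rg hA hT' ho hne hoRg (hle.trans_lt hoA) fun a ha => hle.trans_lt (haT a ha)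
  -- now the graph
  refine ⟨δ, hδpos, hδ1, fun G _ hΔ L W D T R N j₀ j₁ hL hj₁ hTD hTne hJ hkits hreach => ?_⟩
  -- Step II: a level with many contacts
  obtain ⟨j, hjJ, hII⟩ := hL.stepII hΔ hp1 (N := N) hj₁ hJ hreach
  have hjR : j ≤ R := (Finset.mem_Icc.1 hjJ).2.trans hj₁
  -- the kit at that level
  obtain ⟨σ, S, hσ, hN, hIII, hSX, hSD, hSseed, hUS, hIV⟩ := hkits j hjJ
  -- Steps III–V
  exact hL.targetLemma_of_kit hσ hjR hN hSX hSD hSseed hUS hTD hTne hε hε1 hδpos hδc' h3δ h12 hII hIII hIV hC3'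

/-- **The uniform target property, unconditionally**, on every countable vertex type, for every degree bound `Δ` and every `p < 1` —
builds on p205010 (kernel theorem, internal audit signed; external expert review pending) through `avoidingGluing_KN`.
[cite: KozmaNitzan2024, §4 Lemma 10 (pp. 17–22)] -/
theorem targetPropertyU_KN [Countable V] {Δ : ℕ} (p : unitInterval) (hp1 : (p : ℝ) < 1) : TargetPropertyU V Δ p :=
  targetPropertyU_of_avoidingGluing avoidingGluing_KN p hp1

/-- **Back to the per-graph property** (nothing landed is disturbed). [cite: KozmaNitzan2024, §4 Lemma 10 (p. 17)] -/
theorem TargetPropertyU.targetProperty {Δ : ℕ} {p : unitInterval} (h : TargetPropertyU V Δ p) {G : SimpleGraph V} [G.LocallyFinite]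
    (hΔ : ∀ x, G.degree x ≤ Δ) : TargetProperty G Δ p :=
  fun _ hε => by
    obtain ⟨δ, hδ, hδ1, h'⟩ := h hε
    exact ⟨δ, hδ, hδ1, h' G hΔ⟩

/-! ## §2 Uniform chains -/

/-- **One application to a step with kits, uniformly in the graph.** [cite: KozmaNitzan2024, §4 Lemma 10 (p. 17)] -/
theorem TargetPropertyU.apply_step {Δ : ℕ} {p : unitInterval} (hT : TargetPropertyU V Δ p) {ε : ℝ} (hε : 0 < ε) :
    ∃ δ : ℝ, 0 < δ ∧ δ ≤ 1 ∧ ∀ (G : SimpleGraph V) [G.LocallyFinite], (∀ x, G.degree x ≤ Δ) →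
      ∀ (W : Sym2 V → unitInterval) (s : TStep G), s.KitsAt W p Δ δ →
      1 - δ < (prodBernoulli W).real s.L.reachB → 1 - ε < (prodBernoulli W).real (⋃ t ∈ s.T, openConn s.L.o t) := by
  obtain ⟨δ, hδ, hδ1, h⟩ := hT hε
  refine ⟨δ, hδ, hδ1, fun G _ hΔ W s hk hreach => ?_⟩
  obtain ⟨hL, hj, hTD, hTne, hJ, hkits⟩ := hk
  exact h G hΔ s.L W s.D s.T s.R s.N s.j₀ s.j₁ hL hj hTD hTne hJ hkits hreach

/-- **Uniform CHAINS of target steps**: for every `ε > 0` and `n` ONE `δ ∈ (0, 1]` serving every graph on `V` with degrees `≤ Δ`, every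
weighting and every linked chain of `n + 1` steps with kits at accuracy `δ` (body of `TargetProperty.chain` verbatim).
[cite: KozmaNitzan2024, §4 Lemma 11 (p. 22), Lemma 12 (p. 24)] -/
theorem TargetPropertyU.chain {Δ : ℕ} {p : unitInterval} (hT : TargetPropertyU V Δ p) (n : ℕ) {ε : ℝ} (hε : 0 < ε) :
    ∃ δ : ℝ, 0 < δ ∧ δ ≤ 1 ∧ ∀ (G : SimpleGraph V) [G.LocallyFinite], (∀ x, G.degree x ≤ Δ) →
      ∀ (W : Sym2 V → unitInterval) (s : Fin (n + 1) → TStep G),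
      (∀ i : Fin (n + 1), (s i).L.o = (s 0).L.o) →
      (∀ i : Fin n, (s (Fin.castSucc i)).T ⊆ (s i.succ).L.X 0) →
      (∀ i : Fin (n + 1), (s i).KitsAt W p Δ δ) →
      1 - δ < (prodBernoulli W).real (s 0).L.reachB →
        1 - ε < (prodBernoulli W).real (⋃ t ∈ (s (Fin.last n)).T, openConn (s 0).L.o t) := by
  induction n generalizing ε with
  | zero =>
    obtain ⟨δ, hδ, hδ1, h⟩ := hT.apply_step hε
    refine ⟨δ, hδ, hδ1, fun G _ hΔ W s _ _ hk hreach => ?_⟩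
    exact h G hΔ W (s 0) (hk 0) hreach
  | succ n ih =>
    -- the last step at `ε`, the first `n + 1` steps at `ε' = δ_last`
    obtain ⟨δ₁, hδ₁, hδ₁1, hlast⟩ := hT.apply_step hε
    obtain ⟨δ₀, hδ₀, hδ₀1, hfirst⟩ := ih hδ₁
    refine ⟨min δ₀ δ₁, lt_min hδ₀ hδ₁, (min_le_left _ _).trans hδ₀1, fun G _ hΔ W s ho hlink hk hreach => ?_⟩
    -- the truncated chain
    set s' : Fin (n + 1) → TStep G := fun i => s (Fin.castSucc i) with hs'
    have ho' : ∀ i : Fin (n + 1), (s' i).L.o = (s' 0).L.o := fun i => by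
      simp only [hs']; rw [ho (Fin.castSucc i)]; exact (ho (Fin.castSucc 0)).symm
    have hlink' : ∀ i : Fin n, (s' (Fin.castSucc i)).T ⊆ (s' i.succ).L.X 0 := fun i => by
      simp only [hs']
      have := hlink (Fin.castSucc i)
      have e : (Fin.castSucc i).succ = Fin.castSucc i.succ := Fin.ext (by simp)
      rwa [e] at this
    have hk' : ∀ i : Fin (n + 1), (s' i).KitsAt W p Δ δ₀ := fun i => (hk (Fin.castSucc i)).mono (min_le_left _ _)
    have h0 : (s' 0).L.o = (s 0).L.o := rfl
    have hreach' : 1 - δ₀ < (prodBernoulli W).real (s' 0).L.reachB := by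
      have : (s' 0) = s 0 := rfl
      rw [this]; exact lt_of_le_of_lt (by linarith [min_le_left δ₀ δ₁]) hreach
    have hmid := hfirst G hΔ W s' ho' hlink' hk' hreach'
    -- `T_n ⊆ X_{n+1}(0)`: the last step's `B` is reached
    have hlastlink : (s' (Fin.last n)).T ⊆ (s (Fin.last (n + 1))).L.X 0 := by
      have := hlink (Fin.last n)
      simp only [hs']
      rwa [Fin.succ_last] at this
    have holast : (s (Fin.last (n + 1))).L.o = (s 0).L.o := ho _
    have hreachLast : 1 - δ₁ < (prodBernoulli W).real (s (Fin.last (n + 1))).L.reachB := by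
      refine lt_of_lt_of_le ?_ (real_reachB_ge_of_subset W (s := s' (Fin.last n)) (s' := s (Fin.last (n + 1)))
        (by rw [holast]; exact ho' (Fin.last n) |>.trans h0 |>.symm) hlastlink)
      have e : (s' (Fin.last n)).L.o = (s 0).L.o := (ho' (Fin.last n)).trans h0
      rw [e]; exact hmid
    have := hlast G hΔ W (s (Fin.last (n + 1))) ((hk _).mono (min_le_right _ _)) hreachLast
    rwa [holast] at this

/-- **Uniform CHAINS with enlarged targets** (edge contacts): for every `ε > 0` and `n` ONE `δ ∈ (0, 1]` serving every graph on `V` with degrees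
`≤ Δ` — every weighting, every chain `s₀, …, s_n` with a common source, true targets `T'_i ⊆ T_i` linked by `T'_i ⊆ X_{i+1}(0)`, kits at
accuracy `δ`, excess `P_W(o ↔ T_i \ T'_i) ≤ η ≤ δ/2`: `1 - δ < P_W(o ↔ X_0(0))` implies `1 - ε < P_W(o ↔ T'_n)` (body of p2-g2's
`TargetProperty.chain_edge` verbatim).  With this, the scheme picks ONE `δ_chain` for all stub anchors `β`.
[cite: KozmaNitzan2024, §4 Lemma 11 (p. 22), Lemma 12 (pp. 23–25)] -/
theorem TargetPropertyU.chain_edge {Δ : ℕ} {p : unitInterval} (hT : TargetPropertyU V Δ p) (n : ℕ) {ε : ℝ} (hε : 0 < ε) :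
    ∃ δ : ℝ, 0 < δ ∧ δ ≤ 1 ∧ ∀ (G : SimpleGraph V) [G.LocallyFinite], (∀ x, G.degree x ≤ Δ) →
      ∀ (W : Sym2 V → unitInterval) (s : Fin (n + 1) → TStep G) (T' : Fin (n + 1) → Finset V) (η : ℝ),
      (∀ i : Fin (n + 1), (s i).L.o = (s 0).L.o) →
      (∀ i : Fin n, T' (Fin.castSucc i) ⊆ (s i.succ).L.X 0) →
      (∀ i : Fin (n + 1), T' i ⊆ (s i).T) →
      (∀ i : Fin (n + 1), (s i).KitsAt W p Δ δ) →
      η ≤ δ / 2 →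
      (∀ i : Fin (n + 1), (prodBernoulli W).real (⋃ t ∈ (s i).T \ T' i, openConn (s 0).L.o t) ≤ η) →
      1 - δ < (prodBernoulli W).real (s 0).L.reachB →
        1 - ε < (prodBernoulli W).real (⋃ t ∈ T' (Fin.last n), openConn (s 0).L.o t) := by
  induction n generalizing ε with
  | zero =>
    obtain ⟨δ₁, hδ₁, hδ₁1, h⟩ := hT.apply_step (half_pos hε)
    refine ⟨min δ₁ ε, lt_min hδ₁ hε, (min_le_left _ _).trans hδ₁1, fun G _ hΔ W s T' η _ _ hsub hk hη hexc hreach => ?_⟩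
    have h1 := h G hΔ W (s 0) ((hk 0).mono (min_le_left _ _)) (lt_of_le_of_lt (by linarith [min_le_left δ₁ ε]) hreach)
    have h2 := real_biUnion_openConn_le_add_sdiff (prodBernoulli W) (s 0).L.o (hsub 0)
    have h3 := hexc 0
    have h4 : η ≤ ε / 2 := hη.trans (by linarith [min_le_right δ₁ ε])
    show 1 - ε < (prodBernoulli W).real (⋃ t ∈ T' 0, openConn (s 0).L.o t)
    linarith
  | succ n ih =>
    obtain ⟨δ₁, hδ₁, hδ₁1, hlast⟩ := hT.apply_step (half_pos hε)
    obtain ⟨δ₀, hδ₀, hδ₀1, hfirst⟩ := ih hδ₁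
    refine ⟨min δ₀ (min δ₁ ε), lt_min hδ₀ (lt_min hδ₁ hε), (min_le_left _ _).trans hδ₀1,
      fun G _ hΔ W s T' η ho hlink hsub hk hη hexc hreach => ?_⟩
    have hmin0 : min δ₀ (min δ₁ ε) ≤ δ₀ := min_le_left _ _
    have hmin1 : min δ₀ (min δ₁ ε) ≤ δ₁ := (min_le_right _ _).trans (min_le_left _ _)
    have hminε : min δ₀ (min δ₁ ε) ≤ ε := (min_le_right _ _).trans (min_le_right _ _)
    -- the truncated chain
    set s' : Fin (n + 1) → TStep G := fun i => s (Fin.castSucc i) with hs'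
    set T'' : Fin (n + 1) → Finset V := fun i => T' (Fin.castSucc i) with hT''
    have ho' : ∀ i : Fin (n + 1), (s' i).L.o = (s' 0).L.o := fun i => by
      simp only [hs']; rw [ho (Fin.castSucc i)]; exact (ho (Fin.castSucc 0)).symm
    have h0 : (s' 0).L.o = (s 0).L.o := rfl
    have hlink' : ∀ i : Fin n, T'' (Fin.castSucc i) ⊆ (s' i.succ).L.X 0 := fun i => by
      simp only [hs', hT'']
      have := hlink (Fin.castSucc i)
      have e : (Fin.castSucc i).succ = Fin.castSucc i.succ := Fin.ext (by simp)
      rwa [e] at this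
    have hsub' : ∀ i : Fin (n + 1), T'' i ⊆ (s' i).T := fun i => hsub (Fin.castSucc i)
    have hk' : ∀ i : Fin (n + 1), (s' i).KitsAt W p Δ δ₀ := fun i => (hk (Fin.castSucc i)).mono hmin0
    have hη' : η ≤ δ₀ / 2 := hη.trans (by linarith)
    have hexc' : ∀ i : Fin (n + 1), (prodBernoulli W).real (⋃ t ∈ (s' i).T \ T'' i, openConn (s' 0).L.o t) ≤ η := fun i => by
      rw [h0]; exact hexc (Fin.castSucc i)
    have hreach' : 1 - δ₀ < (prodBernoulli W).real (s' 0).L.reachB := by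
      have : (s' 0) = s 0 := rfl
      rw [this]; exact lt_of_le_of_lt (by linarith) hreach
    have hmid := hfirst G hΔ W s' T'' η ho' hlink' hsub' hk' hη' hexc' hreach'
    -- `T'_n ⊆ X_{n+1}(0)`: the last step's core is reached
    have hlastlink : T'' (Fin.last n) ⊆ (s (Fin.last (n + 1))).L.X 0 := by
      have := hlink (Fin.last n)
      simp only [hT'']
      rwa [Fin.succ_last] at this
    have holast : (s (Fin.last (n + 1))).L.o = (s 0).L.o := ho _
    have hsubB : (⋃ t ∈ T'' (Fin.last n), openConn (s 0).L.o t) ⊆ (s (Fin.last (n + 1))).L.reachB := by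
      intro ω hω
      simp only [Set.mem_iUnion, exists_prop] at hω
      obtain ⟨t, ht, hωt⟩ := hω
      unfold LData.reachB
      rw [holast]
      exact Set.mem_biUnion (Finset.mem_coe.2 (hlastlink ht)) hωt
    have hreachLast : 1 - δ₁ < (prodBernoulli W).real (s (Fin.last (n + 1))).L.reachB := by
      rw [h0] at hmid
      exact lt_of_lt_of_le hmid (measureReal_mono hsubB (measure_ne_top _ _))
    have h1 := hlast G hΔ W (s (Fin.last (n + 1))) ((hk _).mono hmin1) hreachLast
    rw [holast] at h1
    have h2 := real_biUnion_openConn_le_add_sdiff (prodBernoulli W) (s 0).L.o (hsub (Fin.last (n + 1)))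
    have h3 := hexc (Fin.last (n + 1))
    have h4 : η ≤ ε / 2 := hη.trans (by linarith)
    linarith

end KNLevels

end Transplant

end Summit.CriticalPhenomena.PercolationContinuityZ3.Theorems

end
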